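import Summits.BirchSwinnertonDyer.Rank1Residual.Additive.TateThreeIntegral
import HarnessLib

/-!
# Tate's algorithm at `3` in integers, II: the starred types are excluded; assembly (`I₀*` or non-minimal)

HONEST FRAMING (cell `b2b-bsdres`, run/shared/lean/b2b/bsd-rank1-residual/, verbatim in every
file): the goal of the cell is to DELETE the COMBINATION-SHAPED residual classes of the
Birch–Swinnerton-Dyer formula for ALL analytic-rank `≤ 1` elliptic curves over `ℚ` — "full BSD
formula for every rank `≤ 1` curve in class `C`" assembled STRICTLY from published theorems — so
that the rank-`≤ 1` remainder becomes exactly the CONSTRUCTION-SHAPED classes, which are TYPED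
(missing-input `Prop`s), NOT attempted. This is not "finishing BSD". Sub-cell `additive-p2`
(X3♯(G-ord)/X4♯(G-ord): additive `p`, potentially good ORDINARY), generation 10: research route;
no claim beyond the stated classes; theorems only, no definition, no named fact.

WHAT THIS FILE DOES. Continuation of `TateThreeIntegral.lean` (notation there: cubic model
`y² = x³ + Ax² + Bx + C` over `ℤ`, `c = A² − 3B = c₄`, `D = A²B² − 4B³ − 4A³C − 27C² + 18ABC
= 2⁸Δ`, valuation constraint `3^k ∣ c ⇒ 3^{3k} ∣ D`):
* `round_three` — with `9 ∣ A`, `27 ∣ B`, `81 ∣ C` (Tate's Steps 8–10 position), the starred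
  types `IV*` (`3⁴ ∥ C`), `III*` (`3³ ∥ B`), `II*` (`3⁵ ∥ C`) are incompatible with
  `ord₃ D ≥ 3 ord₃ c`: `81 ∣ B` and `729 ∣ C` (Step 11 — non-minimal);
* **`main`** — `3 ∣ c`, `3 ∣ D` and the constraint give, after an integer translation, EITHER
  `3 ∥ A'`, `9 ∣ B'`, `27 ∣ C'` (Kodaira `I₀*`) OR `9 ∣ A'`, `81 ∣ B'`, `729 ∣ C'`;
* `c_of_caseOne` — in the first case `ord₃ c = 2` exactly (so `ord₃ D = 6` when
  `ord₃ D = 3 ord₃ c`: the twisted model `y² = x³ − (A'/3)x² + (B'/9)x − C'/27` has unit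
  discriminant at `3`).
Consumer: `TypeGThreeUnitJ.lean` (`E` additive at `3`, `ord₃ j = 0` ⟹ `E^{(−3)}` good at `3`).

References: J. Tate, LNM 476 (1975) §§7–8; J. H. Silverman, *ATAEC* IV.9.4 (Steps 8–11),
Ex. 4.49; A. Kraus, Manuscripta Math. 69 (1990) 353–385.
-/

namespace Summit.BirchSwinnertonDyer.Rank1Residual.Additive

namespace TateThree

/-! ### Round three (Steps 8–11): `9 ∣ A`, `27 ∣ B`, `81 ∣ C` forces `81 ∣ B`, `729 ∣ C` -/

/-- **Round three.** `9 ∣ A`, `27 ∣ B`, `81 ∣ C` and the valuation constraint for `k = 4, 5`: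
then `81 ∣ B` and `729 ∣ C` — types `IV*` (`3⁴ ∥ C`), `III*` (`3³ ∥ B`), `II*` (`3⁵ ∥ C`) are
incompatible with `ord₃ D ≥ 3 ord₃ c`, so Step 11 (non-minimal: `9 ∣ A, 81 ∣ B, 729 ∣ C`) is
reached. `D = 3⁹ Z`, `Z = 3α²β² − 4β³ − 12α³γ − 9γ² + 18αβγ` for `(A, B, C) = (9α, 27β, 81γ)`.
[folklore] -/
theorem round_three {A B C : ℤ} (hA : (9 : ℤ) ∣ A) (hB : (27 : ℤ) ∣ B) (hC : (81 : ℤ) ∣ C)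
    (hcD4 : (3 : ℤ) ^ 4 ∣ A ^ 2 - 3 * B →
      (3 : ℤ) ^ 12 ∣ A ^ 2 * B ^ 2 - 4 * B ^ 3 - 4 * A ^ 3 * C - 27 * C ^ 2 + 18 * A * B * C)
    (hcD5 : (3 : ℤ) ^ 5 ∣ A ^ 2 - 3 * B →
      (3 : ℤ) ^ 15 ∣ A ^ 2 * B ^ 2 - 4 * B ^ 3 - 4 * A ^ 3 * C - 27 * C ^ 2 + 18 * A * B * C) :
    (81 : ℤ) ∣ B ∧ (729 : ℤ) ∣ C := by
  obtain ⟨α, rfl⟩ := hA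
  obtain ⟨β, rfl⟩ := hB
  obtain ⟨γ, rfl⟩ := hC
  -- `D = 3⁹ Z`
  have e : (9 * α) ^ 2 * (27 * β) ^ 2 - 4 * (27 * β) ^ 3 - 4 * (9 * α) ^ 3 * (81 * γ)
      - 27 * (81 * γ) ^ 2 + 18 * (9 * α) * (27 * β) * (81 * γ) =
      3 ^ 9 * (3 * α ^ 2 * β ^ 2 - 4 * β ^ 3 - 12 * α ^ 3 * γ - 9 * γ ^ 2 + 18 * α * β * γ) := by
    ring
  -- `3⁴ ∣ c` always, so `27 ∣ Z`
  have hc4 : (3 : ℤ) ^ 4 ∣ (9 * α) ^ 2 - 3 * (27 * β) := ⟨α ^ 2 - β, by ring⟩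
  have h12 := hcD4 hc4
  rw [e, show (3 : ℤ) ^ 12 = 3 ^ 9 * 3 ^ 3 by norm_num] at h12
  have hZ27 : (27 : ℤ) ∣ 3 * α ^ 2 * β ^ 2 - 4 * β ^ 3 - 12 * α ^ 3 * γ - 9 * γ ^ 2
      + 18 * α * β * γ := by simpa using (mul_dvd_mul_iff_left (by norm_num)).mp h12
  -- `3 ∣ β`
  have hβ : (3 : ℤ) ∣ β := by
    have h4 : (3 : ℤ) ∣ 4 * β ^ 3 := by
      have e' : 4 * β ^ 3 = 3 * (α ^ 2 * β ^ 2 - 4 * α ^ 3 * γ - 3 * γ ^ 2 + 6 * α * β * γ) -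
          (3 * α ^ 2 * β ^ 2 - 4 * β ^ 3 - 12 * α ^ 3 * γ - 9 * γ ^ 2 + 18 * α * β * γ) := by ring
      rw [e']; exact dvd_sub (dvd_mul_right 3 _) (dvd_trans ⟨9, by norm_num⟩ hZ27)
    exact three_dvd_of_dvd_pow (dvd_of_three_dvd_mul (by norm_num) h4)
  obtain ⟨β', rfl⟩ := hβ
  -- `9 ∣ Z ⇒ 3 ∣ α³ γ`
  have hαγ : (3 : ℤ) ∣ α ^ 3 * γ := by
    have h : (9 : ℤ) ∣ 12 * (α ^ 3 * γ) := by
      have e' : 12 * (α ^ 3 * γ) = 9 * (3 * α ^ 2 * β' ^ 2 - 12 * β' ^ 3 - γ ^ 2 + 6 * α * β' * γ) -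
          (3 * α ^ 2 * (3 * β') ^ 2 - 4 * (3 * β') ^ 3 - 12 * α ^ 3 * γ - 9 * γ ^ 2
            + 18 * α * (3 * β') * γ) := by ring
      rw [e']; exact dvd_sub (dvd_mul_right 9 _) (dvd_trans ⟨3, by norm_num⟩ hZ27)
    have h' : (3 : ℤ) ∣ 4 * (α ^ 3 * γ) := by
      rw [show (12 : ℤ) * (α ^ 3 * γ) = 3 * (4 * (α ^ 3 * γ)) by ring,
        show (9 : ℤ) = 3 * 3 by norm_num] at h
      exact (mul_dvd_mul_iff_left (by norm_num)).mp h
    exact dvd_of_three_dvd_mul (by norm_num) h'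
  by_cases hα : (3 : ℤ) ∣ α
  · -- `27 ∣ A`: `3⁵ ∣ c`, so `3¹⁵ ∣ D`, `3⁶ ∣ Z`
    obtain ⟨α', rfl⟩ := hα
    have hc5 : (3 : ℤ) ^ 5 ∣ (9 * (3 * α')) ^ 2 - 3 * (27 * (3 * β')) := ⟨3 * α' ^ 2 - β', by ring⟩
    have h15 := hcD5 hc5
    rw [e, show (3 : ℤ) ^ 15 = 3 ^ 9 * 3 ^ 6 by norm_num] at h15
    have hZ : (3 : ℤ) ^ 6 ∣ 3 * (3 * α') ^ 2 * (3 * β') ^ 2 - 4 * (3 * β') ^ 3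
        - 12 * (3 * α') ^ 3 * γ - 9 * γ ^ 2 + 18 * (3 * α') * (3 * β') * γ :=
      (mul_dvd_mul_iff_left (by norm_num)).mp h15
    -- `3 ∣ γ`
    have hγ : (3 : ℤ) ∣ γ := by
      have h : (27 : ℤ) ∣ 9 * γ ^ 2 := by
        have e' : 9 * γ ^ 2 = 27 * (9 * α' ^ 2 * β' ^ 2 - 4 * β' ^ 3 - 12 * α' ^ 3 * γ
            + 6 * α' * β' * γ) -
            (3 * (3 * α') ^ 2 * (3 * β') ^ 2 - 4 * (3 * β') ^ 3 - 12 * (3 * α') ^ 3 * γ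
              - 9 * γ ^ 2 + 18 * (3 * α') * (3 * β') * γ) := by ring
        rw [e']; exact dvd_sub (dvd_mul_right 27 _) (dvd_trans ⟨27, by norm_num⟩ hZ)
      have h' : (3 : ℤ) ∣ γ ^ 2 := by
        rw [show (27 : ℤ) = 9 * 3 by norm_num] at h
        exact (mul_dvd_mul_iff_left (by norm_num)).mp h
      exact three_dvd_of_dvd_pow h'
    obtain ⟨γ', rfl⟩ := hγ
    -- `Z = 27 Z'`, `27 ∣ Z'`
    have eZ : 3 * (3 * α') ^ 2 * (3 * β') ^ 2 - 4 * (3 * β') ^ 3 - 12 * (3 * α') ^ 3 * (3 * γ')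
        - 9 * (3 * γ') ^ 2 + 18 * (3 * α') * (3 * β') * (3 * γ') =
        3 ^ 3 * (9 * α' ^ 2 * β' ^ 2 - 4 * β' ^ 3 - 36 * α' ^ 3 * γ' - 3 * γ' ^ 2
          + 18 * α' * β' * γ') := by ring
    rw [eZ, show (3 : ℤ) ^ 6 = 3 ^ 3 * 3 ^ 3 by norm_num] at hZ
    have hZ' : (27 : ℤ) ∣ 9 * α' ^ 2 * β' ^ 2 - 4 * β' ^ 3 - 36 * α' ^ 3 * γ' - 3 * γ' ^ 2
        + 18 * α' * β' * γ' := by simpa using (mul_dvd_mul_iff_left (by norm_num)).mp hZ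
    -- `3 ∣ β'`
    have hβ' : (3 : ℤ) ∣ β' := by
      have h4 : (3 : ℤ) ∣ 4 * β' ^ 3 := by
        have e' : 4 * β' ^ 3 = 3 * (3 * α' ^ 2 * β' ^ 2 - 12 * α' ^ 3 * γ' - γ' ^ 2
            + 6 * α' * β' * γ') -
            (9 * α' ^ 2 * β' ^ 2 - 4 * β' ^ 3 - 36 * α' ^ 3 * γ' - 3 * γ' ^ 2
              + 18 * α' * β' * γ') := by ring
        rw [e']; exact dvd_sub (dvd_mul_right 3 _) (dvd_trans ⟨9, by norm_num⟩ hZ')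
      exact three_dvd_of_dvd_pow (dvd_of_three_dvd_mul (by norm_num) h4)
    obtain ⟨β'', rfl⟩ := hβ'
    -- `3 ∣ γ'`
    have hγ' : (3 : ℤ) ∣ γ' := by
      have h : (9 : ℤ) ∣ 3 * γ' ^ 2 := by
        have e' : 3 * γ' ^ 2 = 9 * (9 * α' ^ 2 * β'' ^ 2 - 12 * β'' ^ 3 - 4 * α' ^ 3 * γ'
            + 6 * α' * β'' * γ') -
            (9 * α' ^ 2 * (3 * β'') ^ 2 - 4 * (3 * β'') ^ 3 - 36 * α' ^ 3 * γ' - 3 * γ' ^ 2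
              + 18 * α' * (3 * β'') * γ') := by ring
        rw [e']; exact dvd_sub (dvd_mul_right 9 _) (dvd_trans ⟨3, by norm_num⟩ hZ')
      have h' : (3 : ℤ) ∣ γ' ^ 2 := by
        rw [show (9 : ℤ) = 3 * 3 by norm_num] at h
        exact (mul_dvd_mul_iff_left (by norm_num)).mp h
      exact three_dvd_of_dvd_pow h'
    obtain ⟨γ'', rfl⟩ := hγ'
    exact ⟨⟨3 * β'', by ring⟩, ⟨γ'', by ring⟩⟩
  · -- `9 ∥ A`: `3 ∣ γ`, then `27 ∣ Z` forces `9 ∣ γ`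
    have hγ : (3 : ℤ) ∣ γ := (Int.prime_three.dvd_or_dvd hαγ).resolve_left
      (fun h ↦ hα (three_dvd_of_dvd_pow h))
    obtain ⟨γ', rfl⟩ := hγ
    have hγ' : (3 : ℤ) ∣ γ' := by
      have h : (27 : ℤ) ∣ 36 * (α ^ 3 * γ') := by
        have e' : 36 * (α ^ 3 * γ') = 27 * (α ^ 2 * β' ^ 2 - 4 * β' ^ 3 - 3 * γ' ^ 2
            + 6 * α * β' * γ') -
            (3 * α ^ 2 * (3 * β') ^ 2 - 4 * (3 * β') ^ 3 - 12 * α ^ 3 * (3 * γ') - 9 * (3 * γ') ^ 2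
              + 18 * α * (3 * β') * (3 * γ')) := by ring
        rw [e']; exact dvd_sub (dvd_mul_right 27 _) hZ27
      have h' : (3 : ℤ) ∣ 4 * (α ^ 3 * γ') := by
        rw [show (36 : ℤ) * (α ^ 3 * γ') = 9 * (4 * (α ^ 3 * γ')) by ring,
          show (27 : ℤ) = 9 * 3 by norm_num] at h
        exact (mul_dvd_mul_iff_left (by norm_num)).mp h
      exact (Int.prime_three.dvd_or_dvd (dvd_of_three_dvd_mul (by norm_num) h')).elim
        (fun h3 ↦ absurd (three_dvd_of_dvd_pow h3) hα) id
    obtain ⟨γ'', rfl⟩ := hγ'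
    exact ⟨⟨β', by ring⟩, ⟨γ'', by ring⟩⟩


/-! ### Assembly -/

/-- **Tate's algorithm at `3` for `y² = x³ + Ax² + Bx + C` with `3 ∣ c₄`, `3 ∣ Δ` and
`ord₃ Δ ≥ 3·ord₃ c₄`** (e.g. `ord₃ j = 0` at an additive prime): after an integer translation
`x ↦ x + t`, EITHER `3 ∥ A'`, `9 ∣ B'`, `27 ∣ C'` (Kodaira `I₀*`: the twist by `−3` has the
`3`-integral model `y² = x³ − (A'/3)x² + (B'/9)x − C'/27` with discriminant `2⁻⁸D/3⁶`) OR
`9 ∣ A'`, `81 ∣ B'`, `729 ∣ C'` (the model `y² = x³ + (A'/9)x² + (B'/81)x + C'/729` is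
`3`-integral with discriminant `2⁻⁸D/3¹²`: the equation was not minimal at `3`). Tate 1975 §7;
Silverman *ATAEC* IV.9.4. [folklore] -/
theorem main {A B C : ℤ} (hc : (3 : ℤ) ∣ A ^ 2 - 3 * B)
    (hD : (3 : ℤ) ∣ A ^ 2 * B ^ 2 - 4 * B ^ 3 - 4 * A ^ 3 * C - 27 * C ^ 2 + 18 * A * B * C)
    (hcD : ∀ k : ℕ, (3 : ℤ) ^ k ∣ A ^ 2 - 3 * B →
      (3 : ℤ) ^ (3 * k) ∣ A ^ 2 * B ^ 2 - 4 * B ^ 3 - 4 * A ^ 3 * C - 27 * C ^ 2 + 18 * A * B * C) :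
    (∃ t : ℤ, (3 : ℤ) ∣ A + 3 * t ∧ ¬ (9 : ℤ) ∣ A + 3 * t ∧ (9 : ℤ) ∣ B + 2 * A * t + 3 * t ^ 2 ∧
        (27 : ℤ) ∣ C + B * t + A * t ^ 2 + t ^ 3) ∨
      (∃ t : ℤ, (9 : ℤ) ∣ A + 3 * t ∧ (81 : ℤ) ∣ B + 2 * A * t + 3 * t ^ 2 ∧
        (729 : ℤ) ∣ C + B * t + A * t ^ 2 + t ^ 3) := by
  have hA := three_dvd_A hc
  have hB := three_dvd_B hA hD
  obtain ⟨hA₀, hB₀, hC₀⟩ := three_dvd_translate_neg (C := C) hA hB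
  -- the valuation constraint is translation invariant
  have hcDt : ∀ (t : ℤ) (k : ℕ), (3 : ℤ) ^ k ∣ (A + 3 * t) ^ 2 - 3 * (B + 2 * A * t + 3 * t ^ 2) →
      (3 : ℤ) ^ (3 * k) ∣ (A + 3 * t) ^ 2 * (B + 2 * A * t + 3 * t ^ 2) ^ 2
        - 4 * (B + 2 * A * t + 3 * t ^ 2) ^ 3
        - 4 * (A + 3 * t) ^ 3 * (C + B * t + A * t ^ 2 + t ^ 3)
        - 27 * (C + B * t + A * t ^ 2 + t ^ 3) ^ 2
        + 18 * (A + 3 * t) * (B + 2 * A * t + 3 * t ^ 2) * (C + B * t + A * t ^ 2 + t ^ 3) := by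
    intro t k hk
    rw [disc_translate]
    rw [c_translate] at hk
    exact hcD k hk
  -- round one on the translated model (`t₀ = −C`)
  have h6 := hcDt (-C) 2 (by
    obtain ⟨a, ha⟩ := hA₀
    obtain ⟨b, hb⟩ := hB₀
    exact ⟨a ^ 2 - b, by rw [ha, hb]; ring⟩)
  rcases round_one hA₀ hB₀ hC₀ h6 with ⟨h9A, h9B, h27C⟩ | ⟨h9A, h9B, h9C⟩
  · exact Or.inl ⟨-C, hA₀, h9A, h9B, h27C⟩
  -- rounds two and three
  obtain ⟨h27B, h27C⟩ := round_two h9A h9B h9C (hcDt (-C) 3) (hcDt (-C) 4)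
  obtain ⟨s, hA₁, hB₁, hC₁⟩ := exists_translate_round_two h9A h27B h27C
  obtain ⟨e₁, e₂, e₃⟩ := translate_translate A B C (-C) s
  rw [e₁] at hA₁
  rw [e₂] at hB₁
  rw [e₃] at hC₁
  obtain ⟨h81B, h729C⟩ := round_three hA₁ hB₁ hC₁ (hcDt (-C + s) 4) (hcDt (-C + s) 5)
  exact Or.inr ⟨-C + s, hA₁, h81B, h729C⟩

/-- In the first case of `main` the `c₄`-invariant has `ord₃` EXACTLY `2`: `9 ∣ A'² − 3B'` and
`27 ∤ A'² − 3B'` (`3 ∥ A'`, `9 ∣ B'`); with `ord₃ D = 3 ord₃ c₄` this is `ord₃ D = 6`, i.e. the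
twisted model's discriminant `D/3⁶` is a `3`-adic unit. [folklore] -/
theorem c_of_caseOne {A B : ℤ} (h3 : (3 : ℤ) ∣ A) (h9 : ¬ (9 : ℤ) ∣ A) (hB : (9 : ℤ) ∣ B) :
    (3 : ℤ) ^ 2 ∣ A ^ 2 - 3 * B ∧ ¬ (3 : ℤ) ^ 3 ∣ A ^ 2 - 3 * B := by
  obtain ⟨a, rfl⟩ := h3
  obtain ⟨b, rfl⟩ := hB
  have ha : ¬ (3 : ℤ) ∣ a := fun h ↦ h9 (by
    rw [show (9 : ℤ) = 3 * 3 by norm_num]; exact mul_dvd_mul_left 3 h)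
  refine ⟨⟨a ^ 2 - 3 * b, by ring⟩, fun h27 ↦ ha ?_⟩
  have h : (3 : ℤ) ^ 3 ∣ 9 * a ^ 2 := by
    have e : 9 * a ^ 2 = ((3 * a) ^ 2 - 3 * (9 * b)) + 3 ^ 3 * b := by ring
    rw [e]; exact dvd_add h27 (dvd_mul_right _ _)
  rw [show (3 : ℤ) ^ 3 = 9 * 3 by norm_num] at h
  exact three_dvd_of_dvd_pow ((mul_dvd_mul_iff_left (by norm_num)).mp h)

end TateThree

end Summit.BirchSwinnertonDyer.Rank1Residual.Additive
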